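import Mathlib
import Summits.AtomisticToContinuum.FouriersLaw.Theses.FeketeSeriesLaw
import Summits.AtomisticToContinuum.FouriersLaw.Theses.JunctionLocality
import Summits.AtomisticToContinuum.FouriersLaw.Theorems.JunctionLocalityHarmonicCalibration
import Summits.AtomisticToContinuum.FouriersLaw.Theorems.JunctionLocalitySuperadditiveResistanceDiagonalSplit
import Summits.AtomisticToContinuum.FouriersLaw.Theorems.BondHeatUncertaintyPositiveOrInfiniteLimitDischarge
import Summits.AtomisticToContinuum.FouriersLaw.Theorems.OddSectorIrreversibilityBoundedResponseConvergesOfSeriesLaw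
import Summits.AtomisticToContinuum.FouriersLaw.Theorems.ContactEchoEpochsPinnedSteadyStateExists
import Summits.AtomisticToContinuum.FouriersLaw.Theorems.FourierGreenKuboFourierFiniteResponseOfUnique
import Literature.Barriers.AtomisticToContinuum.HarmonicCrystalBallisticProofs
import Literature.Barriers.AtomisticToContinuum.FixedLengthNoConductivityControl

/-!
# STRATEGY CENSUS (typed companion) — crux `FeketeSeriesLaw.QuasiSubadditiveResistance`
# (stmt-AtomisticToContinuum-14041), crux-strategist REDIRECT seat r1, 2026-08-17

The crux (QS): along the weak-NESS shell of `pinnedChain ω₂ lam β γ` (all `> 0`), for every `T > 0` and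
response coefficients `D`, `∃ C ∀ N M ≥ 2, R_{N+M} ≤ R_N + R_M + C` with `R_N := (N-1)/D_N` — the series
law with bounded junction defect (the SUBadditive half; the SUPERadditive half is the sibling crux
`JunctionLocality.SuperadditiveResistance`, stmt-11748).

This file is the kernel-checked part of `STRATEGY-CENSUS.md` (same directory). Contents:

* §1 `Shell`, `QuasiSub`, `crux_iff_shell` — the crux is its quantifier prefix applied to an arithmetic
  conclusion on the response sequence; `shell_mono`.
* §2 POSITION ("the summit in costume, modulo the residual"): `fouriersLaw_iff_boundedResponse_of_crux`
  (QS ⟹ (FouriersLaw ↔ BoundedResponse): given the crux, the sub-problem collapses to its own necessary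
  waypoint), `positiveOrInfiniteLimit_of_crux` (QS ⟹ stmt-9128, the positivity-and-convergence half,
  verdict open-problem ×5), `conductanceLowerBound_of_crux` (QS ⟹ stmt-11749, the Ohmic floor).
* §3 SEPARATING WITNESSES for the two BC2 probes, which both FAIL (folder `bc/`):
  `sPattern_witness` — a positive response sequence with `D_N → 1` (the conclusion pattern of Fourier's law,
  and of the superadditive half, and of the Ohmic floor) violating the QS conclusion: `S ⇏ QS` at the
  level of conclusions (QS carries a one-sided `O(1/N)` RATE); `quasiSub_of_resistance_bounded` +
  `harmonicCorner_quasiSub_not_fouriersLawFor` — at `lam = β = 0` the QS conclusion HOLDS along the harmonic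
  steady-state family while `FouriersLawFor` FAILS: `QS ⇏ S` in the sibling setting.
* §4 STRENGTHEN: `Concave`, `IncrementCeiling` — the two rigid one-sided forms that imply QS by pure real
  analysis (`crux_of_concave`, `crux_of_incrementCeiling`, concluding the crux BY NAME), and
  `parityWitness` showing both are STRICTLY stronger than QS.
* §5 DECOMPOSITION (the best typed split found, NOT filed — see the census for why): the mirror of the
  landed diagonal split of stmt-11748,
  `crux_of_evenDoublingSub_of_superadditiveResistance : Shell EvenDoublingSub →
  JunctionLocality.SuperadditiveResistance → QuasiSubadditiveResistance` (glue PROVED), necessity of the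
  diagonal piece (`evenDoublingSub_of_crux`), and load-bearing witnesses for both pieces
  (`sPattern_witness`: SR ∧ floor ∧ ¬QS; `indicatorWitness`: EvenDoublingSub ∧ floor ∧ ¬QS ∧ ¬SR).

Pure glue and real analysis over landed theorems; standard axioms; no `sorry`.
-/

noncomputable section

open Filter Topology Set MeasureTheory

namespace Summit.AtomisticToContinuum.FouriersLaw.Cruxes.QuasiSubadditiveResistance.StrategyCensus

open Literature.MathematicalPhysics.KineticTheory.HeatConduction
open Summit.AtomisticToContinuum.FouriersLaw.Theses
open Summit.AtomisticToContinuum.FouriersLaw.Theses.FeketeSeriesLaw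

/-! ## §1 The shell -/

/-- The crux's quantifier prefix applied to a conclusion `P D` on the response sequence. [folklore] -/
def Shell (P : (ℕ → ℝ) → Prop) : Prop :=
  ∀ ω₂ lam β γ : ℝ, 0 < ω₂ → 0 < lam → 0 < β → 0 < γ →
    (∀ (N : ℕ) (T_L T_R : ℝ), 0 < T_L → 0 < T_R → ∀ μ ν : Measure (PhaseSpace N),
      (pinnedChain ω₂ lam β γ).IsSteadyState N T_L T_R μ →
        (pinnedChain ω₂ lam β γ).IsSteadyState N T_L T_R ν → μ = ν) →
    ∀ μ : (N : ℕ) → ℝ → ℝ → Measure (PhaseSpace N),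
      (∀ (N : ℕ) (T_L T_R : ℝ), 0 < T_L → 0 < T_R →
        (pinnedChain ω₂ lam β γ).IsSteadyState N T_L T_R (μ N T_L T_R)) →
      ∀ T : ℝ, 0 < T → ∀ D : ℕ → ℝ,
        (∀ N : ℕ, Tendsto (fun δ : ℝ =>
          (pinnedChain ω₂ lam β γ).totalCurrent (μ N (T + δ / 2) (T - δ / 2)) / δ)
            (𝓝[≠] 0) (𝓝 (D N))) → P D

/-- The arithmetic conclusion of the crux (ℕ-subtraction casts exactly as in the route decl). [folklore] -/
def QuasiSub (D : ℕ → ℝ) : Prop :=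
  ∃ C : ℝ, ∀ N M : ℕ, 2 ≤ N → 2 ≤ M →
    ((N + M - 1 : ℕ) : ℝ) / D (N + M) ≤ ((N - 1 : ℕ) : ℝ) / D N + ((M - 1 : ℕ) : ℝ) / D M + C

/-- Read-back: the crux IS `Shell QuasiSub`. [folklore] -/
theorem crux_iff_shell : QuasiSubadditiveResistance ↔ Shell QuasiSub := Iff.rfl

/-- Monotonicity of the shell in its conclusion, with the PROVED positivity of the conductances
(`Stubs.positiveConductance_holds`, item 11750) made available to the implication. [folklore] -/
theorem shell_mono {P Q : (ℕ → ℝ) → Prop}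
    (h : ∀ D : ℕ → ℝ, (∀ N : ℕ, 2 ≤ N → 0 < D N) → P D → Q D) : Shell P → Shell Q := by
  intro hP ω₂ lam β γ hω hl hβ hγ hU μ hμ T hT D hD
  have hpos : ∀ N : ℕ, 2 ≤ N → 0 < D N :=
    Summit.AtomisticToContinuum.FouriersLaw.Cruxes.BoundedResponseConverges.TwoScaleGluingLogRigidity.Stubs.positiveConductance_holds
      ω₂ lam β γ hω hl hβ hγ hU μ hμ T hT D hD
  exact h D hpos (hP ω₂ lam β γ hω hl hβ hγ hU μ hμ T hT D hD)

/-! ## §2 Position: the crux modulo the residual is the summit -/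

/-- **QS ⟹ (FouriersLaw ↔ BoundedResponse).** Given the crux, the sub-problem `FouriersLaw` is
EQUIVALENT to its own necessary waypoint `BoundedResponse` (the written-out
`Literature.Barriers.AtomisticToContinuum.HasBoundedResponse` for all parameters, stmt-11071, open-problem):
(⇒) `hasBoundedResponse_of_fouriersLawFor` (unconditional); (⇐) the route's deciding theorem
`FeketeSeriesLaw.closes` with its five other binders discharged by landed theorems
(`feketeGlue_holds`, `NessUnique_holds`, `pinnedSteadyStateExists_proof`, `feketeFiniteResponseOfUnique_holds`,
`positiveConductance_holds`). So the crux carries everything in the summit except the residual. [folklore] -/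
theorem fouriersLaw_iff_boundedResponse_of_crux (hQ : QuasiSubadditiveResistance) :
    _root_.FouriersLaw ↔ BoundedResponse := by
  constructor
  · intro hF ω₂ lam β γ hω hl hβ hγ
    exact Literature.Barriers.AtomisticToContinuum.hasBoundedResponse_of_fouriersLawFor
      (hF ω₂ lam β γ hω hl hβ hγ)
  · intro hB
    exact FeketeSeriesLaw.closes
      Summit.AtomisticToContinuum.FouriersLaw.Cruxes.BoundedResponseConverges.TwoScaleGluingLogRigidity.Stubs.feketeGlue_holds
      NessUnique_holds
      Summit.AtomisticToContinuum.FouriersLaw.Theorems.pinnedSteadyStateExists_proof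
      Summit.AtomisticToContinuum.FouriersLaw.Theorems.FourierGreenKubo.feketeFiniteResponseOfUnique_holds
      Summit.AtomisticToContinuum.FouriersLaw.Cruxes.BoundedResponseConverges.TwoScaleGluingLogRigidity.Stubs.positiveConductance_holds
      hQ hB

/-- **QS ⟹ stmt-9128** (the positivity-and-convergence half of Fourier's law, `D_N → ℓ ∈ (0, +∞]` in
`EReal`; verdict `open-problem` by five prover lineages): landed as
`PositiveOrInfiniteLimit.positiveOrInfiniteLimit_of_quasiSubadditiveResistance`. [folklore] -/
theorem positiveOrInfiniteLimit_of_crux (hQ : QuasiSubadditiveResistance) :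
    BondHeatUncertainty.PositiveOrInfiniteLimit :=
  Summit.AtomisticToContinuum.FouriersLaw.Theorems.PositiveOrInfiniteLimit.positiveOrInfiniteLimit_of_quasiSubadditiveResistance
    hQ

/-- **QS ⟹ stmt-11749** (the `N`-uniform Ohmic floor `liminf D_N > 0`, open in print for every
deterministic anharmonic chain). [folklore] -/
theorem conductanceLowerBound_of_crux (hQ : QuasiSubadditiveResistance) :
    JunctionLocality.ConductanceLowerBound :=
  Summit.AtomisticToContinuum.FouriersLaw.Theorems.PositiveOrInfiniteLimit.conductanceLowerBound_of_positiveOrInfiniteLimit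
    (positiveOrInfiniteLimit_of_crux hQ)

/-! ## §3 Separating witnesses for the two BC2 probes -/

/-- Witness 1: `D₁ K = 1 + 1/√K`, i.e. `R_K = (K-1)/D₁ K = K − √K` — Fourier pattern (`D₁ → 1`),
approached from ABOVE with a non-summable `√K` creep. [folklore] -/
def D₁ (K : ℕ) : ℝ := 1 + 1 / Real.sqrt K

theorem D₁_pos (K : ℕ) : 0 < D₁ K := by
  unfold D₁
  have : 0 ≤ 1 / Real.sqrt K := by positivity
  linarith

theorem D₁_tendsto : Tendsto D₁ atTop (𝓝 1) := by
  have h : Tendsto (fun K : ℕ => (Real.sqrt (K : ℝ))⁻¹) atTop (𝓝 0) :=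
    tendsto_inv_atTop_zero.comp (Real.tendsto_sqrt_atTop.comp tendsto_natCast_atTop_atTop)
  have h2 := h.const_add 1
  simp only [add_zero] at h2
  refine h2.congr fun K => ?_
  simp [D₁, one_div]

/-- The resistance of witness 1: `(K − 1)/D₁ K = K − √K` (`K ≥ 1`). [folklore] -/
theorem resistance_D₁ {K : ℕ} (hK : 1 ≤ K) : ((K : ℝ) - 1) / D₁ K = (K : ℝ) - Real.sqrt K := by
  have hK' : (1 : ℝ) ≤ K := by exact_mod_cast hK
  have hs0 : 0 < Real.sqrt K := Real.sqrt_pos.2 (by linarith)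
  have hs : Real.sqrt K * Real.sqrt K = K := Real.mul_self_sqrt (by linarith)
  have hD : D₁ K = (Real.sqrt K + 1) / Real.sqrt K := by
    unfold D₁; field_simp
  rw [hD, div_div_eq_mul_div, div_eq_iff (by positivity)]
  linear_combination hs

theorem resistance_D₁' {K : ℕ} (hK : 1 ≤ K) : ((K - 1 : ℕ) : ℝ) / D₁ K = (K : ℝ) - Real.sqrt K := by
  rw [Nat.cast_sub hK, Nat.cast_one]; exact resistance_D₁ hK

/-- `√(a² · c) ≤ b · a`-type helper: `√x ≤ y` from `x ≤ y²`, `0 ≤ y`. [folklore] -/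
theorem sqrt_le_of_sq_ge {x y : ℝ} (hy : 0 ≤ y) (h : x ≤ y ^ 2) : Real.sqrt x ≤ y :=
  Real.sqrt_le_iff.2 ⟨hy, h⟩

/-- **`S ⇏ QS` at the level of conclusions.** Witness 1 is positive, tends to `1` (the conclusion
pattern of `FouriersLawFor` clause (ii) with `κ = 1`), and violates the QS conclusion: along
`N = M = 4j²`, `R_{8j²} − 2R_{4j²} = 4j − √8·j ≥ j`. [folklore] -/
theorem not_quasiSub_D₁ : ¬ QuasiSub D₁ := by
  rintro ⟨C, hC⟩
  obtain ⟨j, hj⟩ := exists_nat_gt (max C 0)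
  have hjC : C < j := lt_of_le_of_lt (le_max_left _ _) hj
  have hj0 : (0 : ℝ) < j := lt_of_le_of_lt (le_max_right _ _) hj
  have hj1 : 1 ≤ j := by exact_mod_cast hj0
  set N : ℕ := 4 * j ^ 2 with hN
  have hN2 : 2 ≤ N := by
    have : 1 ≤ j ^ 2 := Nat.one_le_pow _ _ hj1
    omega
  have h := hC N N hN2 hN2
  have hN1 : 1 ≤ N := by omega
  have hNN1 : 1 ≤ N + N := by omega
  rw [resistance_D₁' hNN1, resistance_D₁' hN1] at h
  -- evaluate the square roots
  have hNr : (N : ℝ) = 4 * (j : ℝ) ^ 2 := by simp [hN]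
  have hsN : Real.sqrt (N : ℝ) = 2 * j := by
    rw [hNr, show (4 : ℝ) * (j : ℝ) ^ 2 = (2 * j) ^ 2 by ring, Real.sqrt_sq (by positivity)]
  have hsNN : Real.sqrt ((N + N : ℕ) : ℝ) ≤ 3 * j := by
    apply sqrt_le_of_sq_ge (by positivity)
    push_cast; rw [hNr]; nlinarith
  push_cast at h hsNN
  rw [hsN] at h
  linarith

/-- Witness 1 also satisfies the SUPERadditive series law (conclusion pattern of stmt-11748) with `C = 0`
(`√(N+M) ≤ √N + √M`), and its conductances are bounded below — so `SR ∧ floor ∧ Fourier-pattern ⇏ QS`: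
the diagonal piece of §5 is load-bearing. [folklore] -/
theorem quasiSuper_D₁ : ∀ N M : ℕ, 2 ≤ N → 2 ≤ M →
    ((N : ℝ) - 1) / D₁ N + ((M : ℝ) - 1) / D₁ M - 0 ≤ ((N : ℝ) + (M : ℝ) - 1) / D₁ (N + M) := by
  intro N M hN hM
  have e : ((N : ℝ) + (M : ℝ) - 1) / D₁ (N + M) = (((N + M : ℕ) : ℝ) - 1) / D₁ (N + M) := by
    push_cast; ring_nf
  rw [e, resistance_D₁ (by omega), resistance_D₁ (by omega), resistance_D₁ (by omega)]
  have hsum : Real.sqrt ((N + M : ℕ) : ℝ) ≤ Real.sqrt N + Real.sqrt M := by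
    apply sqrt_le_of_sq_ge (by positivity)
    have hN0 : (0 : ℝ) ≤ N := by positivity
    have hM0 : (0 : ℝ) ≤ M := by positivity
    push_cast
    nlinarith [Real.sq_sqrt hN0, Real.sq_sqrt hM0, Real.sqrt_nonneg (N : ℝ), Real.sqrt_nonneg (M : ℝ),
      mul_nonneg (Real.sqrt_nonneg (N : ℝ)) (Real.sqrt_nonneg (M : ℝ))]
  push_cast at hsum ⊢
  linarith

/-- **The separating witness for `S → QS`, packaged.** [folklore] -/
theorem sPattern_witness :
    ∃ D : ℕ → ℝ, (∀ N : ℕ, 0 < D N) ∧ Tendsto D atTop (𝓝 1) ∧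
      (∀ N M : ℕ, 2 ≤ N → 2 ≤ M →
        ((N : ℝ) - 1) / D N + ((M : ℝ) - 1) / D M - 0 ≤ ((N : ℝ) + (M : ℝ) - 1) / D (N + M)) ∧
      ¬ QuasiSub D :=
  ⟨D₁, D₁_pos, D₁_tendsto, quasiSuper_D₁, not_quasiSub_D₁⟩

/-- **Bounded nonnegative resistances satisfy the QS conclusion** (the ballistic pattern): if
`0 ≤ R_N ≤ B` for `N ≥ 2` then `R_{N+M} ≤ B ≤ R_N + R_M + B`. [folklore] -/
theorem quasiSub_of_resistance_bounded {D : ℕ → ℝ} {B : ℝ}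
    (h0 : ∀ N : ℕ, 2 ≤ N → 0 ≤ ((N : ℝ) - 1) / D N)
    (hB : ∀ N : ℕ, 2 ≤ N → ((N : ℝ) - 1) / D N ≤ B) : QuasiSub D := by
  refine ⟨B, fun N M hN hM => ?_⟩
  rw [Nat.cast_sub (show 1 ≤ N + M by omega), Nat.cast_sub (show 1 ≤ N by omega),
    Nat.cast_sub (show 1 ≤ M by omega)]
  push_cast
  have h1 := hB (N + M) (by omega)
  have h2 := h0 N hN
  have h3 := h0 M hM
  push_cast at h1
  linarith

/-- **`QS ⇏ S` in the sibling setting (the harmonic corner).** For the pinned HARMONIC chain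
`pinnedChain ω₂ 0 0 γ` (`ω₂, γ > 0`) there is a steady-state family along which, for every `T > 0`, EVERY
response sequence satisfies the QS conclusion (bounded resistances, `JunctionLocality.HarmonicCalibration`,
PROVED: `harmonicCalibration_proof`), while `FouriersLawFor` FAILS (`not_fouriersLawFor_harmonic`,
ballistic transport). The crux's analogue is decided TRUE exactly where the summit's analogue is decided
FALSE: the crux does not contain the residual `BoundedResponse`. [folklore] -/
theorem harmonicCorner_quasiSub_not_fouriersLawFor {ω₂ γ : ℝ} (hω : 0 < ω₂) (hγ : 0 < γ) :
    ∃ μ : (N : ℕ) → ℝ → ℝ → Measure (PhaseSpace N),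
      (∀ (N : ℕ) (T_L T_R : ℝ), 0 < T_L → 0 < T_R →
        (pinnedChain ω₂ 0 0 γ).IsSteadyState N T_L T_R (μ N T_L T_R)) ∧
      (∀ T : ℝ, 0 < T → ∀ D : ℕ → ℝ,
        (∀ N : ℕ, Tendsto (fun δ : ℝ =>
          (pinnedChain ω₂ 0 0 γ).totalCurrent (μ N (T + δ / 2) (T - δ / 2)) / δ)
            (𝓝[≠] 0) (𝓝 (D N))) → QuasiSub D) ∧
      ¬ (pinnedChain ω₂ 0 0 γ).FouriersLawFor := by
  obtain ⟨μ, hμ, hT⟩ :=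
    Summit.AtomisticToContinuum.FouriersLaw.Theorems.JunctionLocality.harmonicCalibration_proof ω₂ γ hω hγ
  refine ⟨μ, hμ, fun T hTpos D hD => ?_,
    Literature.Barriers.AtomisticToContinuum.not_fouriersLawFor_harmonic hω hγ⟩
  obtain ⟨D₀, hD₀, hpos, -, B, hB⟩ := hT T hTpos
  have hDD : D = D₀ := funext fun N => tendsto_nhds_unique (hD N) (hD₀ N)
  subst hDD
  refine quasiSub_of_resistance_bounded (fun N hN => ?_) hB
  have h2 : (2 : ℝ) ≤ N := by exact_mod_cast hN
  exact div_nonneg (by linarith) (hpos N hN).le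

/-! ## §4 Strengthen — the rigid one-sided forms that imply QS, and why they are strictly stronger -/

/-- Resistance in real-cast form. -/
def R (D : ℕ → ℝ) (K : ℕ) : ℝ := ((K : ℝ) - 1) / D K

/-- From the real-cast conclusion to the crux's ℕ-cast conclusion. [folklore] -/
theorem quasiSub_of_real {D : ℕ → ℝ} {C : ℝ}
    (h : ∀ N M : ℕ, 2 ≤ N → 2 ≤ M → R D (N + M) ≤ R D N + R D M + C) : QuasiSub D := by
  refine ⟨C, fun N M hN hM => ?_⟩
  have h' := h N M hN hM
  simp only [R] at h'
  rw [Nat.cast_sub (show 1 ≤ N + M by omega), Nat.cast_sub (show 1 ≤ N by omega),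
    Nat.cast_sub (show 1 ≤ M by omega)]
  push_cast at h' ⊢
  exact h'

/-- **S⁺₁ `Concave`**: the one-site increments `R_{K+1} − R_K` are non-increasing from `K = 2` on
(diminishing marginal resistance). TRUE in the kinetic slab caricature (Cauchy–Schwarz), a SIGN statement
about second differences across three chain lengths for the real chain. [folklore] -/
def Concave (D : ℕ → ℝ) : Prop := ∀ K : ℕ, 2 ≤ K → R D (K + 2) - R D (K + 1) ≤ R D (K + 1) - R D K

theorem incr_antitone_of_concave {D : ℕ → ℝ} (hc : Concave D) :
    ∀ a b : ℕ, 2 ≤ a → a ≤ b → R D (b + 1) - R D b ≤ R D (a + 1) - R D a := by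
  intro a b ha hab
  induction b, hab using Nat.le_induction with
  | base => exact le_rfl
  | succ b hab ih =>
    have h := hc b (le_trans ha hab)
    have e : b + 1 + 1 = b + 2 := by ring
    rw [e]
    linarith

/-- **`Concave ⟹ QS`** with `C = 2(R_3 − R_2) − R_2`: appending `M` sites to an `N`-chain (`N ≥ 2`) costs at
most what sites `3, …, M+2` cost, which is at most `R_M + 2(R_3 − R_2) − R_2`. [folklore] -/
theorem quasiSub_of_concave {D : ℕ → ℝ} (hc : Concave D) : QuasiSub D := by
  have mono := incr_antitone_of_concave hc
  -- appending M sites to an N-chain costs at most R(M+2) - R 2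
  have key : ∀ M N : ℕ, 2 ≤ N → R D (N + M) - R D N ≤ R D (M + 2) - R D 2 := by
    intro M
    induction M with
    | zero => intro N _; simp
    | succ M ih =>
      intro N hN
      have h1 := ih N hN
      have h2 := mono (M + 2) (N + M) (by omega) (by omega)
      have e1 : N + (M + 1) = N + M + 1 := by ring
      have e2 : M + 1 + 2 = M + 2 + 1 := by ring
      rw [e1, e2]
      linarith
  refine quasiSub_of_real (C := 2 * (R D 3 - R D 2) - R D 2) fun N M hN hM => ?_
  have h1 := key M N hN
  have h2 := mono 2 M le_rfl hM
  have h3 := mono 2 (M + 1) le_rfl (by omega)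
  have e : M + 1 + 1 = M + 2 := by ring
  rw [e] at h3
  norm_num at h2 h3
  linarith

/-- `Concave` lifted through the shell concludes the crux BY NAME. [folklore] -/
theorem crux_of_concave : Shell Concave → QuasiSubadditiveResistance :=
  shell_mono fun _ _ hc => quasiSub_of_concave hc

/-- **S⁺₂ `IncrementCeiling`**: no one-site increment past length `N` exceeds the average resistance per
site of the `N`-chain by more than `B/N` ("no late steepening"; the mirror of the sibling census's
`IncrementDomination`). [folklore] -/
def IncrementCeiling (D : ℕ → ℝ) : Prop :=
  ∃ B : ℝ, ∀ N K : ℕ, 2 ≤ N → N ≤ K → (N : ℝ) * (R D (K + 1) - R D K) ≤ R D N + B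

/-- **`IncrementCeiling ⟹ QS`** with the same constant: for `N ≤ M`, `R_{M+N} − R_M` is a sum of `N`
increments past length `M ≥ N`, each `≤ (R_N + B)/N`. [folklore] -/
theorem quasiSub_of_incrementCeiling {D : ℕ → ℝ} (h : IncrementCeiling D) : QuasiSub D := by
  obtain ⟨B, hB⟩ := h
  -- appending n ≤ N sites to an M-chain with M ≥ N
  have key : ∀ N M : ℕ, 2 ≤ N → N ≤ M → ∀ n : ℕ, n ≤ N →
      R D (M + n) - R D M ≤ (n : ℝ) * ((R D N + B) / N) := by
    intro N M hN hNM n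
    induction n with
    | zero => intro _; simp
    | succ n ih =>
      intro hn
      have h1 := ih (by omega)
      have h2 := hB N (M + n) hN (by omega)
      have hNpos : (0 : ℝ) < N := by exact_mod_cast (show 0 < N by omega)
      have h3 : R D (M + n + 1) - R D (M + n) ≤ (R D N + B) / N := by
        rw [le_div_iff₀ hNpos]; linarith
      have e : M + (n + 1) = M + n + 1 := by ring
      rw [e]; push_cast
      linarith
  have half : ∀ N M : ℕ, 2 ≤ N → N ≤ M → R D (M + N) ≤ R D N + R D M + B := by
    intro N M hN hNM
    have h := key N M hN hNM N le_rfl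
    have hNpos : (0 : ℝ) < N := by exact_mod_cast (show 0 < N by omega)
    have e : (N : ℝ) * ((R D N + B) / N) = R D N + B := by field_simp
    rw [e] at h
    linarith
  refine quasiSub_of_real (C := B) fun N M hN hM => ?_
  rcases le_total N M with hNM | hMN
  · have h := half N M hN hNM
    rw [show N + M = M + N by ring]
    linarith
  · have h := half M N hM hMN
    linarith

/-- `IncrementCeiling` lifted through the shell concludes the crux BY NAME. [folklore] -/
theorem crux_of_incrementCeiling : Shell IncrementCeiling → QuasiSubadditiveResistance :=
  shell_mono fun _ _ h => quasiSub_of_incrementCeiling h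

/-- Parity witness: `D₃ K = (K−1)/(K + (−1)^K)`, i.e. `R_K = K + (−1)^K` (`K ≥ 2`). [folklore] -/
def D₃ (K : ℕ) : ℝ := ((K : ℝ) - 1) / ((K : ℝ) + (-1) ^ K)

theorem neg_one_pow_bounds (K : ℕ) : (-1 : ℝ) ≤ (-1) ^ K ∧ (-1 : ℝ) ^ K ≤ 1 := by
  rcases Nat.even_or_odd K with h | h
  · rw [h.neg_one_pow]; norm_num
  · rw [h.neg_one_pow]; norm_num

theorem D₃_pos {K : ℕ} (hK : 2 ≤ K) : 0 < D₃ K := by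
  have h2 : (2 : ℝ) ≤ K := by exact_mod_cast hK
  have hb := neg_one_pow_bounds K
  unfold D₃
  exact div_pos (by linarith) (by linarith)

theorem resistance_D₃ {K : ℕ} (hK : 2 ≤ K) : R D₃ K = (K : ℝ) + (-1) ^ K := by
  have h2 : (2 : ℝ) ≤ K := by exact_mod_cast hK
  have hb := neg_one_pow_bounds K
  have hne : (K : ℝ) - 1 ≠ 0 := by linarith
  have hne' : (K : ℝ) + (-1) ^ K ≠ 0 := by linarith
  unfold R D₃
  field_simp

/-- **Both rigid forms are STRICTLY stronger than QS.** The parity witness `R_K = K + (−1)^K` satisfies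
the QS conclusion (`C = 3`) but is neither `Concave` (at `K = 2`: `R_2, R_3, R_4 = 3, 2, 5`) nor
`IncrementCeiling` (odd `K = N`: `N · 3 ≤ N − 1 + B` fails). Betting on either adds unprotected content
(`O(1)` parity oscillation of the contact correction is not excluded for the anharmonic chain). [folklore] -/
theorem parityWitness : QuasiSub D₃ ∧ ¬ Concave D₃ ∧ ¬ IncrementCeiling D₃ := by
  refine ⟨?_, ?_, ?_⟩
  · refine quasiSub_of_real (C := 3) fun N M hN hM => ?_
    rw [resistance_D₃ (by omega), resistance_D₃ hN, resistance_D₃ hM]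
    have h1 := neg_one_pow_bounds (N + M)
    have h2 := neg_one_pow_bounds N
    have h3 := neg_one_pow_bounds M
    push_cast
    linarith [h1.2, h2.1, h3.1]
  · intro hc
    have h := hc 2 le_rfl
    rw [resistance_D₃ (by norm_num), resistance_D₃ (by norm_num), resistance_D₃ (by norm_num)] at h
    norm_num at h
  · rintro ⟨B, hB⟩
    obtain ⟨k, hk⟩ := exists_nat_gt B
    -- N = K = 2k+3 (odd)
    have h := hB (2 * k + 3) (2 * k + 3) (by omega) le_rfl
    rw [resistance_D₃ (by omega), resistance_D₃ (by omega)] at h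
    have ho : Odd (2 * k + 3) := ⟨k + 1, by ring⟩
    have he : Even (2 * k + 3 + 1) := ⟨k + 2, by ring⟩
    rw [he.neg_one_pow, ho.neg_one_pow] at h
    push_cast at h
    nlinarith

/-! ## §5 Decomposition — the mirror of the landed diagonal split (glue PROVED, not filed) -/

/-- Piece 1 (new, the DIAGONAL of QS, ℤ₂-symmetric junction): bounded doubling excess,
`R_{2N} ≤ 2R_N + C₁` for `N ≥ 2`. [folklore] -/
def EvenDoublingSub (D : ℕ → ℝ) : Prop :=
  ∃ C₁ : ℝ, ∀ N : ℕ, 2 ≤ N → ((N : ℝ) + (N : ℝ) - 1) / D (N + N) ≤ 2 * (((N : ℝ) - 1) / D N) + C₁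

/-- Piece 2 = the conclusion of the sibling crux `JunctionLocality.SuperadditiveResistance` (stmt-11748),
verbatim. [folklore] -/
def QuasiSuper (D : ℕ → ℝ) : Prop :=
  ∃ C : ℝ, ∀ N M : ℕ, 2 ≤ N → 2 ≤ M →
    ((N : ℝ) - 1) / D N + ((M : ℝ) - 1) / D M - C ≤ ((N : ℝ) + (M : ℝ) - 1) / D (N + M)

/-- **Slope bound.** Positivity, bounded doubling excess and the superadditive series law bound the
resistivity: `R_n ≤ K·n` for `n ≥ 2` (dyadic iteration of the doubling bound, then superadditivity
`R_n ≤ R_{2^{k+1}} + C` with `n < 2^k ≤ 2n`). [folklore] -/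
theorem slope_bound {D : ℕ → ℝ} (hpos : ∀ N : ℕ, 2 ≤ N → 0 < D N) {C₁ C : ℝ}
    (hd : ∀ N : ℕ, 2 ≤ N → R D (N + N) ≤ 2 * R D N + C₁)
    (hs : ∀ N M : ℕ, 2 ≤ N → 2 ≤ M → R D N + R D M - C ≤ R D (N + M)) :
    ∃ K : ℝ, ∀ n : ℕ, 2 ≤ n → R D n ≤ K * n := by
  have hRpos : ∀ N : ℕ, 2 ≤ N → 0 < R D N := by
    intro N hN
    have h2 : (2 : ℝ) ≤ N := by exact_mod_cast hN
    exact div_pos (by linarith) (hpos N hN)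
  set A : ℝ := R D 2 + |C₁| with hA
  have hApos : 0 < A := by have := hRpos 2 le_rfl; positivity
  -- dyadic bound
  have dyad' : ∀ k : ℕ, 1 ≤ k → R D (2 ^ k) ≤ (2 : ℝ) ^ k * A - |C₁| := by
    intro k hk
    induction k, hk using Nat.le_induction with
    | base =>
      simp only [pow_one]
      have := hRpos 2 le_rfl
      rw [hA]; linarith [abs_nonneg C₁]
    | succ k hk ih =>
      have h2k : 2 ≤ 2 ^ k := by
        calc 2 = 2 ^ 1 := by norm_num
          _ ≤ 2 ^ k := Nat.pow_le_pow_right (by norm_num) hk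
      have h := hd (2 ^ k) h2k
      have e : 2 ^ k + 2 ^ k = 2 ^ (k + 1) := by ring
      rw [e] at h
      have hC₁ : C₁ ≤ |C₁| := le_abs_self C₁
      calc R D (2 ^ (k + 1)) ≤ 2 * R D (2 ^ k) + C₁ := h
        _ ≤ 2 * ((2 : ℝ) ^ k * A - |C₁|) + |C₁| := by linarith
        _ = (2 : ℝ) ^ (k + 1) * A - |C₁| := by rw [pow_succ]; ring
  have dyad : ∀ k : ℕ, 1 ≤ k → R D (2 ^ k) ≤ (2 : ℝ) ^ k * A := fun k hk => by
    have := dyad' k hk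
    linarith [abs_nonneg C₁]
  refine ⟨4 * A + |C|, fun n hn => ?_⟩
  -- k with n < 2^k ≤ 2n
  set k : ℕ := Nat.log 2 n + 1 with hk
  have hnlt : n < 2 ^ k := Nat.lt_pow_succ_log_self (by norm_num) n
  have hkle : 2 ^ k ≤ 2 * n := by
    have := Nat.pow_log_le_self 2 (show n ≠ 0 by omega)
    rw [hk, pow_succ]; omega
  have hk1 : 1 ≤ k := by omega
  have h2k : 2 ≤ 2 ^ k := by
    calc 2 = 2 ^ 1 := by norm_num
      _ ≤ 2 ^ k := Nat.pow_le_pow_right (by norm_num) hk1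
  -- m := 2^(k+1) - n ≥ 2 and n + m = 2^(k+1)
  have hm2 : 2 ≤ 2 ^ (k + 1) - n := by
    have : 2 ^ (k + 1) = 2 ^ k + 2 ^ k := by ring
    omega
  have hsup := hs n (2 ^ (k + 1) - n) hn hm2
  have e : n + (2 ^ (k + 1) - n) = 2 ^ (k + 1) := by
    have : 2 ^ (k + 1) = 2 ^ k + 2 ^ k := by ring
    omega
  rw [e] at hsup
  have hmpos := hRpos (2 ^ (k + 1) - n) hm2
  have hdy := dyad (k + 1) (by omega)
  have hpowle : (2 : ℝ) ^ (k + 1) ≤ 4 * n := by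
    have : 2 ^ (k + 1) ≤ 4 * n := by rw [pow_succ]; omega
    exact_mod_cast this
  have hn0 : (0 : ℝ) ≤ n := by positivity
  have hCabs : C ≤ |C| := le_abs_self C
  have hn1 : (1 : ℝ) ≤ n := by exact_mod_cast (show 1 ≤ n by omega)
  calc R D n ≤ R D (2 ^ (k + 1)) + C - R D (2 ^ (k + 1) - n) := by linarith
    _ ≤ (2 : ℝ) ^ (k + 1) * A + |C| := by linarith
    _ ≤ 4 * n * A + |C| * n := by nlinarith [abs_nonneg C]
    _ = (4 * A + |C|) * n := by ring

/-- **Real-analysis core of the mirror split.** For `D_N > 0` (`N ≥ 2`): bounded doubling excess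
(`R_{2N} ≤ 2R_N + C₁`) and the superadditive series law (`R_N + R_M − C ≤ R_{N+M}`) imply the subadditive
series law `R_{N+M} ≤ R_N + R_M + (2C₁ + C)`. Proof: `a := R − C` is superadditive with bounded slopes
(`slope_bound`), so the tree's restricted Fekete lemma gives `ℓ = lim R_N/N = sup` and the UPPER envelope
`R_N ≤ ℓN + C`; the doubling excess, iterated along `2^k N` (`le_of_doubling_of_tendsto_div` applied to
`ℓN − R_N`), gives the LOWER envelope `R_N ≥ ℓN − C₁`. [folklore] -/
theorem quasiSub_of_evenDoublingSub_of_quasiSuper {D : ℕ → ℝ}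
    (hpos : ∀ N : ℕ, 2 ≤ N → 0 < D N) (hd : EvenDoublingSub D) (hsq : QuasiSuper D) :
    QuasiSub D := by
  obtain ⟨C₁, hC₁⟩ := hd
  obtain ⟨C, hC⟩ := hsq
  -- both hypotheses in `R`-form
  have hd' : ∀ N : ℕ, 2 ≤ N → R D (N + N) ≤ 2 * R D N + C₁ := by
    intro N hN
    have h := hC₁ N hN
    simp only [R]; push_cast; linarith
  have hs' : ∀ N M : ℕ, 2 ≤ N → 2 ≤ M → R D N + R D M - C ≤ R D (N + M) := by
    intro N M hN hM
    have h := hC N M hN hM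
    simp only [R]; push_cast; linarith
  have hRpos : ∀ N : ℕ, 2 ≤ N → 0 < R D N := by
    intro N hN
    have h2 : (2 : ℝ) ≤ N := by exact_mod_cast hN
    exact div_pos (by linarith) (hpos N hN)
  -- superadditive Fekete for a := R - C
  obtain ⟨K, hK⟩ := slope_bound hpos hd' hs'
  set a : ℕ → ℝ := fun n => R D n - C with ha
  have hsa : ∀ n m : ℕ, 2 ≤ n → 2 ≤ m → a n + a m ≤ a (n + m) := by
    intro n m hn hm
    have := hs' n m hn hm
    simp only [ha]; linarith
  have hslope : ∀ n : ℕ, 2 ≤ n → a n / n ≤ K + |C| := by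
    intro n hn
    have hn0 : (0 : ℝ) < n := by exact_mod_cast (show 0 < n by omega)
    have hn1 : (1 : ℝ) ≤ n := by exact_mod_cast (show 1 ≤ n by omega)
    rw [div_le_iff₀ hn0]
    simp only [ha]
    have := hK n hn
    nlinarith [abs_nonneg C, neg_abs_le C]
  obtain ⟨ℓ, hlim, hle⟩ :=
    Summit.AtomisticToContinuum.FouriersLaw.Theorems.boundedResponseConverges_tendsto_div_of_superadditive hsa hslope
  -- upper envelope: R n ≤ ℓ n + C
  have hup : ∀ n : ℕ, 2 ≤ n → R D n ≤ ℓ * n + C := by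
    intro n hn
    have hn0 : (0 : ℝ) < n := by exact_mod_cast (show 0 < n by omega)
    have h := hle n hn
    rw [div_le_iff₀ hn0] at h
    simp only [ha] at h
    linarith
  -- lower envelope from the doubling excess: g' := ℓ n - R n satisfies 2 g' N - C₁ ≤ g' (2N), g'/n → 0
  set g : ℕ → ℝ := fun n => ℓ * n - R D n with hg
  have hgd : ∀ N : ℕ, 2 ≤ N → 2 * g N - C₁ ≤ g (N + N) := by
    intro N hN
    have h := hd' N hN
    simp only [hg]; push_cast; linarith
  have hglim : Tendsto (fun n : ℕ => g n / n) atTop (𝓝 0) := by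
    -- a n / n → ℓ and C / n → 0, so R n / n → ℓ and g n / n = ℓ - R n / n → 0 (for n ≥ 1)
    have h1 : Tendsto (fun n : ℕ => a n / n + C / n) atTop (𝓝 (ℓ + 0)) :=
      hlim.add (tendsto_const_div_atTop_nhds_zero_nat C)
    rw [add_zero] at h1
    have h2 : Tendsto (fun n : ℕ => ℓ - (a n / n + C / n)) atTop (𝓝 (ℓ - ℓ)) :=
      tendsto_const_nhds.sub h1
    rw [sub_self] at h2
    refine h2.congr' ?_
    filter_upwards [eventually_ge_atTop 1] with n hn
    have hn0 : (n : ℝ) ≠ 0 := by exact_mod_cast (show n ≠ 0 by omega)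
    simp only [ha, hg]
    field_simp
    ring
  have hlow : ∀ N : ℕ, 2 ≤ N → g N ≤ C₁ :=
    Summit.AtomisticToContinuum.FouriersLaw.Theorems.SuperadditiveResistance.DiagonalSplit.le_of_doubling_of_tendsto_div
      hgd hglim
  -- conclude
  refine quasiSub_of_real (C := C₁ + C₁ + C) fun N M hN hM => ?_
  have h1 := hup (N + M) (by omega)
  have h2 := hlow N hN
  have h3 := hlow M hM
  simp only [hg] at h2 h3
  push_cast at h1
  linarith

/-- **The mirror split at crux level: `Shell EvenDoublingSub → SuperadditiveResistance (stmt-11748) →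
QuasiSubadditiveResistance (stmt-14041)`**, glue PROVED; positivity supplied by the landed
`positiveConductance_holds`. Together with the landed `DiagonalSplit.superadditiveResistance_of_subs'`
(`EvenDoubling → QS → SR`) this shows: GIVEN EITHER full one-sided series law, the OTHER reduces to its own
diagonal — and that filing both splits would be CIRCULAR (each consumes the other's parent as a leaf).
[folklore] -/
theorem crux_of_evenDoublingSub_of_superadditiveResistance :
    Shell EvenDoublingSub → JunctionLocality.SuperadditiveResistance → QuasiSubadditiveResistance := by
  intro hE hS ω₂ lam β γ hω hl hβ hγ hU μ hμ T hT D hD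
  have hpos : ∀ N : ℕ, 2 ≤ N → 0 < D N :=
    Summit.AtomisticToContinuum.FouriersLaw.Cruxes.BoundedResponseConverges.TwoScaleGluingLogRigidity.Stubs.positiveConductance_holds
      ω₂ lam β γ hω hl hβ hγ hU μ hμ T hT D hD
  exact quasiSub_of_evenDoublingSub_of_quasiSuper hpos (hE ω₂ lam β γ hω hl hβ hγ hU μ hμ T hT D hD)
    (hS ω₂ lam β γ hω hl hβ hγ hU μ hμ T hT D hD hpos)

/-- Piece 1 is NECESSARY (`M := N` in the crux). [folklore] -/
theorem evenDoublingSub_of_quasiSub {D : ℕ → ℝ} (h : QuasiSub D) : EvenDoublingSub D := by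
  obtain ⟨C, hC⟩ := h
  refine ⟨C, fun N hN => ?_⟩
  have h := hC N N hN hN
  rw [Nat.cast_sub (show 1 ≤ N + N by omega), Nat.cast_sub (show 1 ≤ N by omega)] at h
  push_cast at h
  linarith

theorem evenDoublingSub_of_crux : QuasiSubadditiveResistance → Shell EvenDoublingSub :=
  shell_mono fun _ _ h => evenDoublingSub_of_quasiSub h

/-- Witness 2: `R_K = K + √K · 𝟙[3 ∣ K]`, i.e. `D₂ K = 1 − 1/√K` if `3 ∣ K`, else `1 − 1/K`. [folklore] -/
def D₂ (K : ℕ) : ℝ := if 3 ∣ K then 1 - 1 / Real.sqrt K else 1 - 1 / (K : ℝ)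

theorem one_lt_sqrt_of_two_le {K : ℕ} (hK : 2 ≤ K) : 1 < Real.sqrt K := by
  have h2 : (2 : ℝ) ≤ K := by exact_mod_cast hK
  rw [show (1 : ℝ) = Real.sqrt 1 by simp]
  exact Real.sqrt_lt_sqrt (by norm_num) (by linarith)

theorem D₂_pos {K : ℕ} (hK : 2 ≤ K) : 0 < D₂ K := by
  have h2 : (2 : ℝ) ≤ K := by exact_mod_cast hK
  unfold D₂
  split_ifs with h
  · have hs := one_lt_sqrt_of_two_le hK
    have : 1 / Real.sqrt K < 1 := by
      rw [div_lt_one (by linarith)]; exact hs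
    linarith
  · have : 1 / (K : ℝ) < 1 := by
      rw [div_lt_one (by linarith)]; linarith
    linarith

theorem resistance_D₂_dvd {K : ℕ} (hK : 2 ≤ K) (h3 : 3 ∣ K) : R D₂ K = (K : ℝ) + Real.sqrt K := by
  have h2 : (2 : ℝ) ≤ K := by exact_mod_cast hK
  have hs1 := one_lt_sqrt_of_two_le hK
  have hs : Real.sqrt K * Real.sqrt K = K := Real.mul_self_sqrt (by linarith)
  have hD : D₂ K = (Real.sqrt K - 1) / Real.sqrt K := by
    unfold D₂; rw [if_pos h3]; field_simp
  unfold R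
  rw [hD, div_div_eq_mul_div, div_eq_iff (by nlinarith)]
  linear_combination (-1 : ℝ) * hs

theorem resistance_D₂_not_dvd {K : ℕ} (hK : 2 ≤ K) (h3 : ¬ 3 ∣ K) : R D₂ K = (K : ℝ) := by
  have h2 : (2 : ℝ) ≤ K := by exact_mod_cast hK
  have hD : D₂ K = ((K : ℝ) - 1) / K := by
    unfold D₂; rw [if_neg h3]; field_simp
  unfold R
  rw [hD, div_div_eq_mul_div, div_eq_iff (by linarith)]
  ring

theorem D₂_tendsto : Tendsto D₂ atTop (𝓝 1) := by
  -- squeeze between 1 - 1/√K and 1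
  have hlow : Tendsto (fun K : ℕ => 1 - (Real.sqrt (K : ℝ))⁻¹) atTop (𝓝 1) := by
    have h : Tendsto (fun K : ℕ => (Real.sqrt (K : ℝ))⁻¹) atTop (𝓝 0) :=
      tendsto_inv_atTop_zero.comp (Real.tendsto_sqrt_atTop.comp tendsto_natCast_atTop_atTop)
    have h2 := h.const_sub 1
    simpa using h2
  refine tendsto_of_tendsto_of_tendsto_of_le_of_le' hlow tendsto_const_nhds ?_ ?_
  · filter_upwards [eventually_ge_atTop 1] with K hK
    have hK1 : (1 : ℝ) ≤ K := by exact_mod_cast hK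
    unfold D₂
    split_ifs with h
    · simp [one_div]
    · -- 1/K ≤ 1/√K since √K ≤ K
      have hsK : Real.sqrt K ≤ K := sqrt_le_of_sq_ge (by linarith) (by nlinarith)
      have hs0 : 0 < Real.sqrt K := Real.sqrt_pos.2 (by linarith)
      have : 1 / (K : ℝ) ≤ (Real.sqrt K)⁻¹ := by
        rw [← one_div]; exact one_div_le_one_div_of_le hs0 hsK
      linarith
  · filter_upwards [eventually_ge_atTop 1] with K hK
    have hK1 : (1 : ℝ) ≤ K := by exact_mod_cast hK
    unfold D₂
    split_ifs with h
    · have : 0 ≤ 1 / Real.sqrt K := by positivity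
      linarith
    · have : 0 ≤ 1 / (K : ℝ) := by positivity
      linarith

/-- Witness 2 has bounded doubling excess (`C₁ = 0`): `3 ∣ 2N ↔ 3 ∣ N`, and `√(2N) ≤ 2√N`. [folklore] -/
theorem evenDoublingSub_D₂ : EvenDoublingSub D₂ := by
  refine ⟨0, fun N hN => ?_⟩
  have e : ((N : ℝ) + (N : ℝ) - 1) / D₂ (N + N) = R D₂ (N + N) := by
    simp only [R]; push_cast; ring_nf
  rw [e, show ((N : ℝ) - 1) / D₂ N = R D₂ N from rfl]
  by_cases h3 : 3 ∣ N
  · have h3' : 3 ∣ N + N := by omega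
    rw [resistance_D₂_dvd (by omega) h3', resistance_D₂_dvd hN h3]
    have hN0 : (0 : ℝ) ≤ N := by positivity
    have hsq : Real.sqrt ((N + N : ℕ) : ℝ) ≤ 2 * Real.sqrt N := by
      apply sqrt_le_of_sq_ge (by positivity)
      push_cast
      nlinarith [Real.sq_sqrt hN0]
    push_cast at hsq ⊢
    linarith
  · have h3' : ¬ 3 ∣ N + N := by omega
    rw [resistance_D₂_not_dvd (by omega) h3', resistance_D₂_not_dvd hN h3]
    push_cast; linarith

/-- Witness 2 violates QS: along `(N, M) = (18j² − 1, 18j² + 1)` (neither divisible by `3`, sum `36j²`),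
`R_{N+M} − R_N − R_M = 6j`. [folklore] -/
theorem not_quasiSub_D₂ : ¬ QuasiSub D₂ := by
  rintro ⟨C, hC⟩
  obtain ⟨j, hj⟩ := exists_nat_gt (max C 0)
  have hjC : C < j := lt_of_le_of_lt (le_max_left _ _) hj
  have hj0 : (0 : ℝ) < j := lt_of_le_of_lt (le_max_right _ _) hj
  have hj1 : 1 ≤ j := by exact_mod_cast hj0
  obtain ⟨t, ht⟩ : ∃ t : ℕ, t = j ^ 2 := ⟨_, rfl⟩
  have ht1 : 1 ≤ t := by rw [ht]; exact Nat.one_le_pow _ _ hj1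
  have h := hC (18 * t - 1) (18 * t + 1) (by omega) (by omega)
  have e1 : 18 * t - 1 + (18 * t + 1) = 36 * t := by omega
  rw [e1] at h
  have hN : ¬ 3 ∣ 18 * t - 1 := by omega
  have hM : ¬ 3 ∣ 18 * t + 1 := by omega
  have hS : 3 ∣ 36 * t := by omega
  have r1 : ((36 * t - 1 : ℕ) : ℝ) / D₂ (36 * t) = R D₂ (36 * t) := by
    simp only [R]; rw [Nat.cast_sub (by omega)]; push_cast; ring_nf
  have r2 : ((18 * t - 1 - 1 : ℕ) : ℝ) / D₂ (18 * t - 1) = R D₂ (18 * t - 1) := by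
    simp only [R]; rw [Nat.cast_sub (by omega)]; push_cast; ring_nf
  have r3 : ((18 * t + 1 - 1 : ℕ) : ℝ) / D₂ (18 * t + 1) = R D₂ (18 * t + 1) := by
    simp only [R]; rw [Nat.cast_sub (by omega)]; push_cast; ring_nf
  rw [r1, r2, r3, resistance_D₂_dvd (by omega) hS, resistance_D₂_not_dvd (by omega) hN,
    resistance_D₂_not_dvd (by omega) hM] at h
  have hsq : Real.sqrt ((36 * t : ℕ) : ℝ) = 6 * j := by
    push_cast; rw [ht]; push_cast
    rw [show (36 : ℝ) * (j : ℝ) ^ 2 = (6 * j) ^ 2 by ring, Real.sqrt_sq (by positivity)]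
  rw [hsq] at h
  have ec : ((18 * t - 1 : ℕ) : ℝ) = 18 * t - 1 := by
    rw [Nat.cast_sub (by omega)]; push_cast; ring
  rw [ec] at h
  push_cast at h
  linarith

/-- Witness 2 violates the SUPERadditive series law too: along `N = M = 36j²`,
`R_N + R_M − R_{2N} = 12j − √72·j ≥ 3j`. [folklore] -/
theorem not_quasiSuper_D₂ : ¬ QuasiSuper D₂ := by
  rintro ⟨C, hC⟩
  obtain ⟨j, hj⟩ := exists_nat_gt (max C 0)
  have hjC : C < j := lt_of_le_of_lt (le_max_left _ _) hj
  have hj0 : (0 : ℝ) < j := lt_of_le_of_lt (le_max_right _ _) hj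
  have hj1 : 1 ≤ j := by exact_mod_cast hj0
  obtain ⟨t, ht⟩ : ∃ t : ℕ, t = j ^ 2 := ⟨_, rfl⟩
  have ht1 : 1 ≤ t := by rw [ht]; exact Nat.one_le_pow _ _ hj1
  have h := hC (36 * t) (36 * t) (by omega) (by omega)
  have e : ((36 * t : ℕ) : ℝ) + ((36 * t : ℕ) : ℝ) - 1 = (((36 * t + 36 * t : ℕ) : ℝ) - 1) := by
    push_cast; ring
  rw [e, show (((36 * t + 36 * t : ℕ) : ℝ) - 1) / D₂ (36 * t + 36 * t) = R D₂ (36 * t + 36 * t) from rfl,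
    show (((36 * t : ℕ) : ℝ) - 1) / D₂ (36 * t) = R D₂ (36 * t) from rfl,
    resistance_D₂_dvd (by omega) (by omega : 3 ∣ 36 * t),
    resistance_D₂_dvd (by omega) (by omega : 3 ∣ 36 * t + 36 * t)] at h
  have htr : (t : ℝ) = (j : ℝ) ^ 2 := by rw [ht]; push_cast; ring
  have hsq : Real.sqrt ((36 * t : ℕ) : ℝ) = 6 * j := by
    push_cast; rw [htr]
    rw [show (36 : ℝ) * (j : ℝ) ^ 2 = (6 * j) ^ 2 by ring, Real.sqrt_sq (by positivity)]
  have hsq2 : Real.sqrt ((36 * t + 36 * t : ℕ) : ℝ) ≤ 9 * j := by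
    apply sqrt_le_of_sq_ge (by positivity)
    push_cast; rw [htr]; nlinarith
  rw [hsq] at h
  push_cast at h hsq2
  linarith

/-- **Load-bearing witness for piece 2.** Witness 2 has bounded doubling excess, positive conductances
tending to `1` (so the Ohmic floor and even the Fourier pattern hold), and violates BOTH series laws:
`EvenDoublingSub ∧ floor ⇏ QS` — the superadditive piece of the mirror split is load-bearing, and the
diagonal alone decides nothing. [folklore] -/
theorem indicatorWitness :
    ∃ D : ℕ → ℝ, (∀ N : ℕ, 2 ≤ N → 0 < D N) ∧ Tendsto D atTop (𝓝 1) ∧ EvenDoublingSub D ∧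
      ¬ QuasiSub D ∧ ¬ QuasiSuper D :=
  ⟨D₂, fun _ hN => D₂_pos hN, D₂_tendsto, evenDoublingSub_D₂, not_quasiSub_D₂, not_quasiSuper_D₂⟩

/-- **Load-bearing witness for piece 1** (= `sPattern_witness` read again): witness 1 satisfies the
superadditive law and the floor and violates QS, hence (by the proved glue) it must violate
`EvenDoublingSub` — the diagonal piece is load-bearing. [folklore] -/
theorem not_evenDoublingSub_D₁ : ¬ EvenDoublingSub D₁ := fun h =>
  not_quasiSub_D₁ (quasiSub_of_evenDoublingSub_of_quasiSuper (fun N _ => D₁_pos N) h ⟨0, quasiSuper_D₁⟩)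

end Summit.AtomisticToContinuum.FouriersLaw.Cruxes.QuasiSubadditiveResistance.StrategyCensus
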